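import Summits.QuantumFields.BalabanUV.Beta.FP.NearRegionCrossBubbleLetters
import Summits.QuantumFields.BalabanUV.Beta.FP.NearRegionCrossBubbleSmear

/-!
# `BalabanUV.Beta.FP.NearRegionCrossBubblePoint` — road «FP» (binder row D1), organisation β of `RHOA-DESIGN.md` §3, row RHOA-3 (N-PC generic), PART 1c:
# THE POINTWISE BOUND OF THE CROSS BUBBLE (translation-invariant leg `F`, two-point leg `R`, two ZERO-MASS exponentially localised vertices) AT EVERY `z ∈ ℤ⁴`
# ([folklore] lattice bookkeeping; nothing of the manuscripts; no road object is typed or touched; `n` does not appear)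

HONEST DEPENDENCY (page 1, mandatory): continuum YM on T⁴ ⇐ BetaPertH ∧ nine spine estimates (0/9 proved); BetaPertH ⇐ (D1) ∧ (D4) ∧
CAP+tail; G-an2-4 gates asym, D1 and NE2/3/4.  HONEST FRAMING (cell contract, verbatim): «discharging `BetaPertH` makes Bałaban's UV
stability UNCONDITIONAL — a real constructive-QFT result; it is NOT the continuum limit and NOT the Clay problem.»  THIS MODULE assembles BY NAME PART 1a
`FP/NearRegionCrossBubbleLetters` (lattice-path letters, outer bookkeeping) and PART 1b `FP/NearRegionCrossBubbleSmear` (double zero-mass identity, product letters)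
in the H2-a currency of `FP/ExpLocalisedBubble{,Point}`.  Every analytic input (the graded decay of `F` and of its differences — the `ExpLocalisedBubblePoint`
letters `A₀, A₁, A₂` at exponents `a, a+1, a+2` —, the GLOBAL letters `B₀, B₁, B₂` of `R`, the localisation and the zero masses of the weights) is a HYPOTHESIS
displayed in the signatures; the module cites nothing, defines nothing, mints no `Prop` fact, 0 sorry.  NOT the road's `R^Q`∕`R^g`∕`P^{BF}`∕`Ḣ` (RHOA-8
instantiates), NOT `ρ_n` bounded, NOT `hasym`, NOT D1, NOT BetaPertH, NOT continuum, NOT Clay.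

ROW (road FP owner d1-p3-g6, `RHOA-DESIGN.md` 7feeae18441b23f4 §3 (N-PC) ∕ §5 RHOA-3, `LEAVES-FP.md` l.309; R-FP-22 (a)).  THE OBJECT: see PART 1b —
`X(z) = Σ'_{q=((y,u),(w′,x′))} c₀ (y,u)·c₁ (w′,x′)·F(z+x′−y)·R u (z+w′)` = `tr((F∘V₀)∘(R∘W_z))` for scalar fibre.

CONTENT ([folklore]).
* **`abs_mixed_integrand_le`** — the doubly-subtracted integrand is GRADED: for every `z` and `q`,
  `|Φ_z q| ≤ (κ₂·B₀/(‖z‖∞+1)^{a+2} + κ₁·B₁/(‖z‖∞+1)^{a+1} + κ₀·B₂/(‖z‖∞+1)^a)·L(q.1)^{a+2}·L(q.2)^{a+2}` (outer `‖z‖∞ ≥ 4` by PART 1a's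
  `abs_mixedDiff_le_outer` ∕ `abs_sub_le_outer` and the global path letters of `R`; core `‖z‖∞ ≤ 3` crude);
* **`abs_cross_le_point` — THE POINTWISE CROSS-BUBBLE BOUND**: two localised weights with ZERO total mass ⟹ for EVERY `z ∈ ℤ⁴`,
  `|X(z)| ≤ (κ₂·B₀/(‖z‖∞+1)^{a+2} + κ₁·B₁/(‖z‖∞+1)^{a+1} + κ₀·B₂/(‖z‖∞+1)^a)·(C₀Θ_{a+2})·(C₁Θ_{a+2})`,
  `κ₂ = 16·2^{a+2}A₂ + 8·20^{a+2}A₀ + 4·4^{a+2}A₀`, `κ₁ = 8·(4·2^{a+1}A₁ + 2·10^{a+1}A₀)`, `κ₀ = 16A₀`, `Θ_m = 2^{m+1}(m!e^{δ/2}(2/δ)^m)e^{δ/2}Zl 4 (δ/2)²`.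
  The three channels are the EXACT powers of E-FP-5-2 once the consumer sets `a = 2`, `B_j = B/n^{2+j}` (PART 2): `B₀/(s+1)⁴`, `B₁/(s+1)³`, `B₂/(s+1)²`.
  NOTE FOR SUPPLIERS (R-FP-20): the only second-difference letter of `R` consumed is the MIXED one (one step in each argument).
Unit `b2b-balaban-gan24-formalise-leaf-05` (gen 36; cross-lane idle G-an2-4 swarm leaf seat on road FP), 2026-08-20; journal INTENT ∕ CLAIM «RHOA-3» l.23369.
-/

noncomputable section

namespace Summit.QuantumFields.BalabanUV.Beta.FP.NearRegionCrossBubblePoint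

open Finset Filter Topology fwdDiff
open scoped BigOperators
open Literature.MathematicalPhysics.QuantumFieldTheory.Balaban1983to89
open Literature.MathematicalPhysics.QuantumFieldTheory.Balaban1983to89.Beta
open B12Sec2to5 (l1 l1_nonneg)
open ExpKernelCalculus (Site Zl Zl_pos l1_sub_symm)
open Summit.QuantumFields.BalabanUV.Beta.FP.ExpLocalisedBubble
open Summit.QuantumFields.BalabanUV.Beta.FP.ExpLocalisedBubblePoint (quarter_bounds nonneg_of_decay_pow)
open Summit.QuantumFields.BalabanUV.Beta.FP.NearRegionCrossBubbleLetters
open Summit.QuantumFields.BalabanUV.Beta.FP.NearRegionCrossBubbleSmear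
open DyadicShell (Pt supNorm supNorm_eq_zero_iff)

section Point

variable {c₀ c₁ : Pt × Pt → ℝ} {F : Pt → ℝ} {R : Pt → Pt → ℝ} {C₀ C₁ δ A₀ A₁ A₂ B₀ B₁ B₂ : ℝ} {a : ℕ}

/-- [folklore] **THE DOUBLY-SUBTRACTED INTEGRAND IS GRADED**: with the `ExpLocalisedBubblePoint` letters of `F` (`A₀, A₁, A₂` at exponents `a, a+1, a+2`) and the
GLOBAL letters `B₀, B₁, B₂` of the two-point `R` (size, unit first differences in either argument, MIXED unit second differences), for every `z` and every
`q = ((y,u),(w′,x′))`,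
`|Φ_z q| ≤ (κ₂·B₀/(‖z‖∞+1)^{a+2} + κ₁·B₁/(‖z‖∞+1)^{a+1} + κ₀·B₂/(‖z‖∞+1)^a)·L(q.1)^{a+2}·L(q.2)^{a+2}`, `L(p) = (|p.1|₁+1)+(|p.2|₁+1)`,
`κ₂ = 16·2^{a+2}A₂ + 8·20^{a+2}A₀ + 4·4^{a+2}A₀`, `κ₁ = 8·(4·2^{a+1}A₁ + 2·10^{a+1}A₀)`, `κ₀ = 16A₀` (near radius `2⌊‖z‖∞/4⌋` for `‖z‖∞ ≥ 4`; crude core). -/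
theorem abs_mixed_integrand_le
    (hF0 : ∀ t : Pt, |F t| ≤ A₀ / ((supNorm t : ℝ) + 1) ^ a)
    (hF1 : ∀ (t : Pt) (i : Fin 4), |Δ_[(Pi.single i 1 : Pt)] F t| ≤ A₁ / ((supNorm t : ℝ) + 1) ^ (a + 1))
    (hF2 : ∀ (t : Pt) (i j : Fin 4), |Δ_[(Pi.single i 1 : Pt)] (Δ_[(Pi.single j 1 : Pt)] F) t| ≤ A₂ / ((supNorm t : ℝ) + 1) ^ (a + 2))
    (hR0 : ∀ u w, |R u w| ≤ B₀)
    (hR1 : ∀ (u w : Pt) (i : Fin 4), |R (u + Pi.single i 1) w - R u w| ≤ B₁)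
    (hR1' : ∀ (u w : Pt) (j : Fin 4), |R u (w + Pi.single j 1) - R u w| ≤ B₁)
    (hR2 : ∀ (u w : Pt) (i j : Fin 4),
      |R (u + Pi.single i 1) (w + Pi.single j 1) - R u (w + Pi.single j 1) - R (u + Pi.single i 1) w + R u w| ≤ B₂)
    (z : Pt) (q : (Pt × Pt) × (Pt × Pt)) :
    |F (z + q.2.2 - q.1.1) * R q.1.2 (z + q.2.1) - F (z + q.2.2) * R 0 (z + q.2.1) - F (z - q.1.1) * R q.1.2 z + F z * R 0 z|
      ≤ ((16 * (2 ^ (a + 2) * A₂) + 8 * 20 ^ (a + 2) * A₀ + 4 * 4 ^ (a + 2) * A₀) * B₀ / ((supNorm z : ℝ) + 1) ^ (a + 2)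
          + (8 * (4 * (2 ^ (a + 1) * A₁) + 2 * 10 ^ (a + 1) * A₀)) * B₁ / ((supNorm z : ℝ) + 1) ^ (a + 1)
          + 16 * A₀ * B₂ / ((supNorm z : ℝ) + 1) ^ a)
        * ((l1 q.1.1 + 1) + (l1 q.1.2 + 1)) ^ (a + 2) * ((l1 q.2.1 + 1) + (l1 q.2.2 + 1)) ^ (a + 2) := by
  obtain ⟨⟨y, u⟩, ⟨w', x'⟩⟩ := q
  simp only
  have hA0 := nonneg_of_decay_pow hF0
  have hA1 : 0 ≤ A₁ := nonneg_of_decay_pow (fun t => hF1 t 0)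
  have hA2 : 0 ≤ A₂ := nonneg_of_decay_pow (fun t => hF2 t 0 0)
  have hB0 : 0 ≤ B₀ := (abs_nonneg _).trans (hR0 0 0)
  have hB1 : 0 ≤ B₁ := (abs_nonneg _).trans (hR1 0 0 0)
  have hB2 : 0 ≤ B₂ := (abs_nonneg _).trans (hR2 0 0 0 0)
  set n : ℝ := (supNorm z : ℝ) with hn
  have hn0 : 0 ≤ n := by positivity
  have hn1 : 0 < n + 1 := by linarith
  -- the one-vertex letters
  set L₀ : ℝ := (l1 y + 1) + (l1 u + 1) with hL₀
  set L₁ : ℝ := (l1 w' + 1) + (l1 x' + 1) with hL₁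
  have hy0 := l1_nonneg y; have hu0 := l1_nonneg u; have hw0 := l1_nonneg w'; have hx0 := l1_nonneg x'
  have hL₀1 : 1 ≤ L₀ := by rw [hL₀]; linarith
  have hL₁1 : 1 ≤ L₁ := by rw [hL₁]; linarith
  have hyL : l1 y ≤ L₀ := by rw [hL₀]; linarith
  have huL : l1 u ≤ L₀ := by rw [hL₀]; linarith
  have hwL : l1 w' ≤ L₁ := by rw [hL₁]; linarith
  have hxL : l1 x' ≤ L₁ := by rw [hL₁]; linarith
  have hLK₀ : L₀ ≤ L₀ ^ (a + 2) := le_self_pow₀ hL₀1 (by omega)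
  have hLK₁ : L₁ ≤ L₁ ^ (a + 2) := le_self_pow₀ hL₁1 (by omega)
  have hPK₀ : 1 ≤ L₀ ^ (a + 2) := one_le_pow₀ hL₀1
  have hPK₁ : 1 ≤ L₁ ^ (a + 2) := one_le_pow₀ hL₁1
  have hLL : 0 ≤ L₀ ^ (a + 2) * L₁ ^ (a + 2) := by positivity
  -- global bound on `F`
  have hFA : ∀ t, |F t| ≤ A₀ := fun t => (hF0 t).trans (div_le_self hA0 (one_le_pow₀ (by
    have := (Nat.cast_nonneg (supNorm t) : (0:ℝ) ≤ _); linarith)))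
  have e4 : ((4 : ℕ) : ℝ) = 4 := by norm_num
  -- the two-point letters along lattice paths (global)
  have hRfst : |R u (z + w') - R 0 (z + w')| ≤ 4 * B₁ * L₀ ^ (a + 2) := by
    have h := abs_sub_fst_le (D := 4) hB1 hR1 u (z + w')
    rw [e4] at h
    exact h.trans (mul_le_mul_of_nonneg_left (huL.trans hLK₀) (by positivity))
  have hRsnd : |R u (z + w') - R u z| ≤ 4 * B₁ * L₁ ^ (a + 2) := by
    have h := abs_sub_snd_le (D := 4) hB1 hR1' u z w'
    rw [e4] at h
    exact h.trans (mul_le_mul_of_nonneg_left (hwL.trans hLK₁) (by positivity))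
  have hRmix : |R u (z + w') - R 0 (z + w') - R u z + R 0 z| ≤ 16 * B₂ * (L₀ ^ (a + 2) * L₁ ^ (a + 2)) := by
    have h := abs_mixedDiff₂_le (D := 4) hB2 hR2 u z w'
    rw [e4] at h
    calc |R u (z + w') - R 0 (z + w') - R u z + R 0 z| ≤ 4 * l1 u * (4 * l1 w' * B₂) := h
      _ = 16 * B₂ * (l1 u * l1 w') := by ring
      _ ≤ 16 * B₂ * (L₀ ^ (a + 2) * L₁ ^ (a + 2)) :=
          mul_le_mul_of_nonneg_left (mul_le_mul (huL.trans hLK₀) (hwL.trans hLK₁) hw0 (by positivity)) (by positivity)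
  -- abbreviations of the three coefficients
  set κ₂ : ℝ := 16 * (2 ^ (a + 2) * A₂) + 8 * 20 ^ (a + 2) * A₀ + 4 * 4 ^ (a + 2) * A₀ with hκ₂
  set κ₁ : ℝ := 8 * (4 * (2 ^ (a + 1) * A₁) + 2 * 10 ^ (a + 1) * A₀) with hκ₁
  set N : ℝ := κ₂ * B₀ / (n + 1) ^ (a + 2) + κ₁ * B₁ / (n + 1) ^ (a + 1) + 16 * A₀ * B₂ / (n + 1) ^ a with hN
  have h16 : 0 ≤ 16 * (2 ^ (a + 2) * A₂) := by positivity
  have h820 : 0 ≤ 8 * 20 ^ (a + 2) * A₀ := by positivity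
  have h44 : 0 ≤ 4 * 4 ^ (a + 2) * A₀ := by positivity
  have hκ₂0 : 0 ≤ κ₂ := by positivity
  have hκ₁0 : 0 ≤ κ₁ := by positivity
  have hN1 : 0 ≤ κ₂ * B₀ / (n + 1) ^ (a + 2) := by positivity
  have hN2 : 0 ≤ κ₁ * B₁ / (n + 1) ^ (a + 1) := by positivity
  have hN3 : 0 ≤ 16 * A₀ * B₂ / (n + 1) ^ a := by positivity
  have hN0 : 0 ≤ N := by positivity
  show _ ≤ N * L₀ ^ (a + 2) * L₁ ^ (a + 2)
  -- T4 (both cases): `F z`·(mixed difference of `R`)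
  have hT4 : |F z * (R u (z + w') - R 0 (z + w') - R u z + R 0 z)| ≤ 16 * A₀ * B₂ / (n + 1) ^ a * (L₀ ^ (a + 2) * L₁ ^ (a + 2)) := by
    rw [abs_mul]
    calc |F z| * |R u (z + w') - R 0 (z + w') - R u z + R 0 z| ≤ A₀ / (n + 1) ^ a * (16 * B₂ * (L₀ ^ (a + 2) * L₁ ^ (a + 2))) :=
          mul_le_mul (hF0 z) hRmix (abs_nonneg _) (by positivity)
      _ = _ := by ring
  by_cases hz : 4 ≤ supNorm z
  · -- OUTER
    set b₁ : ℝ := A₁ * 2 ^ (a + 1) / (n + 1) ^ (a + 1) with hb₁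
    set b₂ : ℝ := A₂ * 2 ^ (a + 2) / (n + 1) ^ (a + 2) with hb₂
    have hb₁0 : 0 ≤ b₁ := by positivity
    have hb₂0 : 0 ≤ b₂ := by positivity
    have hl1neg : l1 (-y) = l1 y := by rw [← zero_sub, l1_sub_symm, sub_zero]
    -- T1
    have hT1 : |(F (z + x' - y) - F (z + x') - F (z - y) + F z) * R u (z + w')|
        ≤ (16 * b₂ + 8 * A₀ * (20 ^ (a + 2) / (n + 1) ^ (a + 2))) * B₀ * (L₀ ^ (a + 2) * L₁ ^ (a + 2)) := by
      rw [abs_mul]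
      calc |F (z + x' - y) - F (z + x') - F (z - y) + F z| * |R u (z + w')|
          ≤ (16 * b₂ + 8 * A₀ * (20 ^ (a + 2) / (n + 1) ^ (a + 2))) * (L₀ ^ (a + 2) * L₁ ^ (a + 2)) * B₀ :=
            mul_le_mul (abs_mixedDiff_le_outer hF0 hF2 hz y x' hL₀1 hL₁1 hyL hxL) (hR0 _ _) (abs_nonneg _) (by positivity)
        _ = _ := by ring
    -- T2
    have hT2 : |(F (z - y) - F z) * (R u (z + w') - R u z)|
        ≤ (4 * b₁ + 2 * A₀ * (10 ^ (a + 1) / (n + 1) ^ (a + 1))) * (4 * B₁) * (L₀ ^ (a + 2) * L₁ ^ (a + 2)) := by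
      rw [abs_mul]
      have hF' : |F (z - y) - F z| ≤ (4 * b₁ + 2 * A₀ * (10 ^ (a + 1) / (n + 1) ^ (a + 1))) * L₀ ^ (a + 2) := by
        have h := abs_sub_le_outer hF0 hF1 hz (-y) hL₀1 (by rw [hl1neg]; exact hyL)
        rwa [← sub_eq_add_neg] at h
      calc |F (z - y) - F z| * |R u (z + w') - R u z|
          ≤ (4 * b₁ + 2 * A₀ * (10 ^ (a + 1) / (n + 1) ^ (a + 1))) * L₀ ^ (a + 2) * (4 * B₁ * L₁ ^ (a + 2)) :=
            mul_le_mul hF' hRsnd (abs_nonneg _) (by positivity)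
        _ = _ := by ring
    -- T3
    have hT3 : |(F (z + x') - F z) * (R u (z + w') - R 0 (z + w'))|
        ≤ (4 * b₁ + 2 * A₀ * (10 ^ (a + 1) / (n + 1) ^ (a + 1))) * (4 * B₁) * (L₀ ^ (a + 2) * L₁ ^ (a + 2)) := by
      rw [abs_mul]
      calc |F (z + x') - F z| * |R u (z + w') - R 0 (z + w')|
          ≤ (4 * b₁ + 2 * A₀ * (10 ^ (a + 1) / (n + 1) ^ (a + 1))) * L₁ ^ (a + 2) * (4 * B₁ * L₀ ^ (a + 2)) :=
            mul_le_mul (abs_sub_le_outer hF0 hF1 hz x' hL₁1 hxL) hRfst (abs_nonneg _) (by positivity)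
        _ = _ := by ring
    -- the four coefficients against `N`
    have hc1 : (16 * b₂ + 8 * A₀ * (20 ^ (a + 2) / (n + 1) ^ (a + 2))) * B₀ ≤ κ₂ * B₀ / (n + 1) ^ (a + 2) := by
      have e : (16 * b₂ + 8 * A₀ * (20 ^ (a + 2) / (n + 1) ^ (a + 2))) * B₀
          = (16 * (2 ^ (a + 2) * A₂) + 8 * 20 ^ (a + 2) * A₀) * B₀ / (n + 1) ^ (a + 2) := by
        rw [hb₂]; ring
      rw [e]
      refine div_le_div_of_nonneg_right (mul_le_mul_of_nonneg_right ?_ hB0) (by positivity)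
      rw [hκ₂]
      linarith
    have hc23 : (4 * b₁ + 2 * A₀ * (10 ^ (a + 1) / (n + 1) ^ (a + 1))) * (4 * B₁)
        + (4 * b₁ + 2 * A₀ * (10 ^ (a + 1) / (n + 1) ^ (a + 1))) * (4 * B₁) = κ₁ * B₁ / (n + 1) ^ (a + 1) := by
      rw [hb₁, hκ₁]; ring
    -- assemble the outer case
    rw [mixed_split]
    have hsum := (abs_add_le _ _).trans
      (add_le_add ((abs_add_le _ _).trans (add_le_add ((abs_add_le _ _).trans (add_le_add hT1 hT2)) hT3)) hT4)
    refine hsum.trans ?_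
    have key : (16 * b₂ + 8 * A₀ * (20 ^ (a + 2) / (n + 1) ^ (a + 2))) * B₀
          + ((4 * b₁ + 2 * A₀ * (10 ^ (a + 1) / (n + 1) ^ (a + 1))) * (4 * B₁)
            + (4 * b₁ + 2 * A₀ * (10 ^ (a + 1) / (n + 1) ^ (a + 1))) * (4 * B₁))
          + 16 * A₀ * B₂ / (n + 1) ^ a ≤ N := by
      rw [hc23, hN]
      linarith
    calc (16 * b₂ + 8 * A₀ * (20 ^ (a + 2) / (n + 1) ^ (a + 2))) * B₀ * (L₀ ^ (a + 2) * L₁ ^ (a + 2))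
          + (4 * b₁ + 2 * A₀ * (10 ^ (a + 1) / (n + 1) ^ (a + 1))) * (4 * B₁) * (L₀ ^ (a + 2) * L₁ ^ (a + 2))
          + (4 * b₁ + 2 * A₀ * (10 ^ (a + 1) / (n + 1) ^ (a + 1))) * (4 * B₁) * (L₀ ^ (a + 2) * L₁ ^ (a + 2))
          + 16 * A₀ * B₂ / (n + 1) ^ a * (L₀ ^ (a + 2) * L₁ ^ (a + 2))
        = ((16 * b₂ + 8 * A₀ * (20 ^ (a + 2) / (n + 1) ^ (a + 2))) * B₀
            + ((4 * b₁ + 2 * A₀ * (10 ^ (a + 1) / (n + 1) ^ (a + 1))) * (4 * B₁)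
              + (4 * b₁ + 2 * A₀ * (10 ^ (a + 1) / (n + 1) ^ (a + 1))) * (4 * B₁))
            + 16 * A₀ * B₂ / (n + 1) ^ a) * (L₀ ^ (a + 2) * L₁ ^ (a + 2)) := by ring
      _ ≤ N * (L₀ ^ (a + 2) * L₁ ^ (a + 2)) := mul_le_mul_of_nonneg_right key hLL
      _ = N * L₀ ^ (a + 2) * L₁ ^ (a + 2) := by ring
  · -- CORE `‖z‖∞ ≤ 3`: crude bounds
    have hz3 : supNorm z ≤ 3 := by omega
    have hn3 : n ≤ 3 := by rw [hn]; exact_mod_cast hz3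
    have hprod : ∀ s t v : Pt, |F s * R t v| ≤ A₀ * B₀ := fun s t v => by
      rw [abs_mul]; exact mul_le_mul (hFA _) (hR0 _ _) (abs_nonneg _) hA0
    have hcrude : |F (z + x' - y) * R u (z + w') - F (z + x') * R 0 (z + w') - F (z - y) * R u z + F z * R 0 z| ≤ 4 * (A₀ * B₀) := by
      have h1 := hprod (z + x' - y) u (z + w'); have h2 := hprod (z + x') 0 (z + w'); have h3 := hprod (z - y) u z
      have h4 := hprod z 0 z
      calc |F (z + x' - y) * R u (z + w') - F (z + x') * R 0 (z + w') - F (z - y) * R u z + F z * R 0 z|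
          ≤ |F (z + x' - y) * R u (z + w') - F (z + x') * R 0 (z + w') - F (z - y) * R u z| + |F z * R 0 z| := abs_add_le _ _
        _ ≤ (|F (z + x' - y) * R u (z + w') - F (z + x') * R 0 (z + w')| + |F (z - y) * R u z|) + |F z * R 0 z| := by
            gcongr; exact abs_sub _ _
        _ ≤ ((|F (z + x' - y) * R u (z + w')| + |F (z + x') * R 0 (z + w')|) + |F (z - y) * R u z|) + |F z * R 0 z| := by
            gcongr; exact abs_sub _ _
        _ ≤ ((A₀ * B₀ + A₀ * B₀) + A₀ * B₀) + A₀ * B₀ := by gcongr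
        _ = 4 * (A₀ * B₀) := by ring
    refine hcrude.trans ?_
    have hcoreN : 4 * (A₀ * B₀) ≤ N := by
      have key : (n + 1) ^ (a + 2) ≤ (4 : ℝ) ^ (a + 2) := pow_le_pow_left₀ (by positivity) (by linarith) _
      have h1 : 4 * (A₀ * B₀) ≤ 4 * 4 ^ (a + 2) * A₀ * B₀ / (n + 1) ^ (a + 2) := by
        rw [le_div_iff₀ (by positivity)]
        calc 4 * (A₀ * B₀) * (n + 1) ^ (a + 2) ≤ 4 * (A₀ * B₀) * (4 : ℝ) ^ (a + 2) := mul_le_mul_of_nonneg_left key (by positivity)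
          _ = 4 * 4 ^ (a + 2) * A₀ * B₀ := by ring
      have h2 : 4 * 4 ^ (a + 2) * A₀ * B₀ / (n + 1) ^ (a + 2) ≤ κ₂ * B₀ / (n + 1) ^ (a + 2) := by
        refine div_le_div_of_nonneg_right (mul_le_mul_of_nonneg_right ?_ hB0) (by positivity)
        rw [hκ₂]
        linarith
      have h3 : κ₂ * B₀ / (n + 1) ^ (a + 2) ≤ N := by rw [hN]; linarith
      exact h1.trans (h2.trans h3)
    calc 4 * (A₀ * B₀) ≤ N := hcoreN
      _ = N * 1 * 1 := by ring
      _ ≤ N * L₀ ^ (a + 2) * L₁ ^ (a + 2) := mul_le_mul (mul_le_mul_of_nonneg_left hPK₀ hN0) hPK₁ zero_le_one (by positivity)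

/-- [folklore] **THE POINTWISE CROSS-BUBBLE BOUND ON `ℤ⁴`** (no `n`, EVERY `z`): two exponentially localised vertex weights with ZERO total mass, a
translation-invariant leg `F` with the graded letters `A₀, A₁, A₂` at exponents `a, a+1, a+2`, a two-point leg `R` with GLOBAL letters `B₀` (size), `B₁` (unit
first differences in either argument), `B₂` (MIXED unit second differences) ⟹
`|X(z)| ≤ (κ₂·B₀/(‖z‖∞+1)^{a+2} + κ₁·B₁/(‖z‖∞+1)^{a+1} + κ₀·B₂/(‖z‖∞+1)^a)·(C₀·Θ_{a+2})·(C₁·Θ_{a+2})`,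
`κ₂ = 16·2^{a+2}A₂ + 8·20^{a+2}A₀ + 4·4^{a+2}A₀`, `κ₁ = 8·(4·2^{a+1}A₁ + 2·10^{a+1}A₀)`, `κ₀ = 16A₀`, `Θ_m = 2^{m+1}(m!e^{δ/2}(2/δ)^m)e^{δ/2}Zl 4 (δ/2)²`. -/
theorem abs_cross_le_point (hδ : 0 < δ)
    (hc₀ : ∀ p : Pt × Pt, |c₀ p| ≤ C₀ * (Real.exp (-δ * l1 p.1) * Real.exp (-δ * l1 p.2)))
    (hc₁ : ∀ p : Pt × Pt, |c₁ p| ≤ C₁ * (Real.exp (-δ * l1 p.1) * Real.exp (-δ * l1 p.2)))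
    (h0 : ∑' p : Pt × Pt, c₀ p = 0) (h1 : ∑' p : Pt × Pt, c₁ p = 0)
    (hF0 : ∀ t : Pt, |F t| ≤ A₀ / ((supNorm t : ℝ) + 1) ^ a)
    (hF1 : ∀ (t : Pt) (i : Fin 4), |Δ_[(Pi.single i 1 : Pt)] F t| ≤ A₁ / ((supNorm t : ℝ) + 1) ^ (a + 1))
    (hF2 : ∀ (t : Pt) (i j : Fin 4), |Δ_[(Pi.single i 1 : Pt)] (Δ_[(Pi.single j 1 : Pt)] F) t| ≤ A₂ / ((supNorm t : ℝ) + 1) ^ (a + 2))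
    (hR0 : ∀ u w, |R u w| ≤ B₀)
    (hR1 : ∀ (u w : Pt) (i : Fin 4), |R (u + Pi.single i 1) w - R u w| ≤ B₁)
    (hR1' : ∀ (u w : Pt) (j : Fin 4), |R u (w + Pi.single j 1) - R u w| ≤ B₁)
    (hR2 : ∀ (u w : Pt) (i j : Fin 4),
      |R (u + Pi.single i 1) (w + Pi.single j 1) - R u (w + Pi.single j 1) - R (u + Pi.single i 1) w + R u w| ≤ B₂)
    (z : Pt) :
    |∑' q : (Pt × Pt) × (Pt × Pt), c₀ q.1 * c₁ q.2 * (F (z + q.2.2 - q.1.1) * R q.1.2 (z + q.2.1))|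
      ≤ ((16 * (2 ^ (a + 2) * A₂) + 8 * 20 ^ (a + 2) * A₀ + 4 * 4 ^ (a + 2) * A₀) * B₀ / ((supNorm z : ℝ) + 1) ^ (a + 2)
          + (8 * (4 * (2 ^ (a + 1) * A₁) + 2 * 10 ^ (a + 1) * A₀)) * B₁ / ((supNorm z : ℝ) + 1) ^ (a + 1)
          + 16 * A₀ * B₂ / ((supNorm z : ℝ) + 1) ^ a)
        * ((C₀ * (2 ^ (a + 2 + 1) * (((a + 2).factorial : ℝ) * Real.exp (δ / 2) * (2 / δ) ^ (a + 2)) * Real.exp (δ / 2) * Zl 4 (δ / 2) ^ 2))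
          * (C₁ * (2 ^ (a + 2 + 1) * (((a + 2).factorial : ℝ) * Real.exp (δ / 2) * (2 / δ) ^ (a + 2)) * Real.exp (δ / 2) * Zl 4 (δ / 2) ^ 2))) := by
  have hA0 := nonneg_of_decay_pow hF0
  have hA1 : 0 ≤ A₁ := nonneg_of_decay_pow (fun t => hF1 t 0)
  have hA2 : 0 ≤ A₂ := nonneg_of_decay_pow (fun t => hF2 t 0 0)
  have hB0 : 0 ≤ B₀ := (abs_nonneg _).trans (hR0 0 0)
  have hB1 : 0 ≤ B₁ := (abs_nonneg _).trans (hR1 0 0 0)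
  have hB2 : 0 ≤ B₂ := (abs_nonneg _).trans (hR2 0 0 0 0)
  have hFA : ∀ t, |F t| ≤ A₀ := fun t => (hF0 t).trans (div_le_self hA0 (one_le_pow₀ (by
    have := (Nat.cast_nonneg (supNorm t) : (0:ℝ) ≤ _); linarith)))
  rw [tsum_cross_eq_tsum_mixed (D := 4) hδ hc₀ hc₁ h0 h1 hFA hR0 z]
  exact abs_tsum_cross_le_of_pow (D := 4) hδ hc₀ hc₁ (by positivity) (a + 2)
    (fun q => abs_mixed_integrand_le hF0 hF1 hF2 hR0 hR1 hR1' hR2 z q)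

end Point

end Summit.QuantumFields.BalabanUV.Beta.FP.NearRegionCrossBubblePoint

end
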